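import Summits.BirchSwinnertonDyer.Rank1Residual.Supersingular.X6RestCellKimTamDefectLocalTorsionTrivial
import Summits.BirchSwinnertonDyer.Rank1Residual.Supersingular.X6KimTamDefectRecordsB
import HarnessLib

/-!
# Leaf `ClassX6 ∧ r_an = 0` (A6), erratum sub-leaf `EisensteinHalfFiveLeErr` of route `PrintX6`: the Tam-defect Err cell `(130798a1, p = 7)` —
# its LOWER half `MissingLowerBoundAt W 7` from ONE depth-2 Kurihara number through the PROOF-COVERED twin of C.-H. Kim's structure
# theorem, with NO Perrin-Riou Prop. 4.8 and NO flagged fact (cell `bsd-print-x6`, seat p2 gen 7, PLAN v4.6 TURNKEY P4-A6OPEN part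
# (T2), cell C5 split off p4-g4's lane by INBOX 19:36Z; helper for stmt-BirchSwinnertonDyer-21115; closes no item)

PARTITION currency (D-0054): leaf A6 = X6 ∧ r_an = 0; ONE cell of the erratum sub-leaf (Tam-defect: `∏c_ℓ = 28`, `ord₇ = 1`; `N = 130798 =
2·17·3847`; the class `130798a` is `residue:X6~` with an EMPTY register on desk A's book R895 — PLAN v4.6 cell C5); per pair; nothing
booked here; BEYOND-PRINT THEOREM: **NO**.

WHY. The road of record `bsdp_x6r0tam_130798a1_7` (`X6KimTamDefectRecordsB`, x10b gen 28) threads TWO inputs outside the cell's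
flag-free base: Kim 2026 Thm 1.8 (6) beyond the unit case, `Kim2026.rankZero_le_padicValNat_sha_of_kuriharaNumber_ne_zero` (ARM-P flag
`K26-(6)-shallow@t>0`), for the LOWER half, and Perrin-Riou 2003 Prop. 4.8 (flag `PR03-Prop4.8-Kato-attribution`) for the UPPER half. Exactly
as p4-g3's p556626 did for the Rest cell `(399190l1, 7)`, this file stops at the lower half and re-threads it through the PROOF-COVERED twin
`Kim2026.rankZero_le_padicValNat_sha_of_kuriharaNumber_ne_zero_of_localTorsionTrivial` (binder `#E(ℚ₇)[7] = 1` discharged on X6 by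
`…_of_nonAnomalous`: good reduction and `a₇ = 0`), via the landed generic layers `X6RankZero.padicValRat_shaAn_le_of_kimLowerLT` /
`X6RankZero.missingLowerBoundAt_of_kimLowerLT` / `X6RankZero.missingLowerBoundAt_of_kimLowerLT_of_ainvs` (p556626, imported — not restated),
reusing the record's KERNEL lemmas by name (`isGloballyMinimal_c130798a1`, `countPoints_c130798a1_7253/17837`, the cyclicity ladders
`card_torsion_le_c130798a1_{7253,17837}_7`) and its displayed binders (`r_an = 0`, `2 ≤ ord₇ ∏c + 1`, the Manin datum `D` with `7 ∤ c_D`, the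
period transfer, `ψ`, the depth-2 Kurihara number `hδ` = `δ̃⁽²⁾_{7253·17837} ≢ 0 (mod 49)` — TWO EXACT engines: engine Q (clean-room Manin
symbols + `exactrec.sparsenull` kernel certificate, kit j241847; value `14 (mod 49)`) and PARI `msfromell` (kit j241528), x10b X6-KURIHARA.md
§28; PLAN v4.6 matrix row C5). The upper half is the route's own PROVED `UpperHalfX6` (from `PublishedInputsX6`), so a `Theorems/PrintX6*`
vehicle (`PrintX6Cell130798a1FromInputs`) closes `BSD(E,7)` at the cell on the route's trust base.

THEOREMS ONLY; no definition, no named fact. References: [Kim2022StructureSelmer] Thm. 1.9 (6), §1.5.1–1.5.3, Prop. 3.2;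
[Miller2011LMS] Def. 1.1; [SilvermanAEC2009] VII.3.1, VII.5.1; [Kraus1989] Prop. 1–2; [Cremona2006] Table 1 (130798a1).
-/

set_option autoImplicit false

noncomputable section

open scoped Classical MatrixGroups ModularForm

open CongruenceSubgroup WeierstrassCurve Literature.NumberTheory.EllipticCurves
  Literature.NumberTheory.EllipticCurves.ModularForms
  Literature.NumberTheory.EllipticCurves.Rank1Residual
  Literature.NumberTheory.EllipticCurves.Rank1Residual.Typed
  Literature.NumberTheory.EllipticCurves.Rank1Residual.X11RankOneCertificates
  Summit.BirchSwinnertonDyer.BirchSwinnertonDyer.Rank1Residual.IntModel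
  Summit.BirchSwinnertonDyer.BirchSwinnertonDyer.Rank1Residual.X11RankOne
  Summit.BirchSwinnertonDyer.Rank1Residual.X11b
  Summit.BirchSwinnertonDyer.Rank1Residual.Additive
  Summit.BirchSwinnertonDyer.Rank1Residual.Supersingular.KuriharaTwist

namespace Summit.BirchSwinnertonDyer.Rank1Residual.Supersingular

/-! ### The cell `(130798a1, 7)` -/

/-- **`130798a1` @ `7`: the typed LOWER half `MissingLowerBoundAt W 7` from ONE depth-2 Kurihara number through the proof-covered Kim
twin — NO Perrin-Riou Prop. 4.8, no flagged fact.** Exactly the data of the road of record `bsdp_x6r0tam_130798a1_7` (N4 TAM-DEFECT cell: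
`N = 130798 = 2·17·3847`, good supersingular at `7` (`a₇ = 0`, `#Ẽ(𝔽₇) = 8`), `∏c_ℓ = 28` (`ord₇ = 1`), `#Ш_an = 49`, `#E(ℚ)_tors = 2`,
Cremona model `[1, 1, 1, −1514781218, −22692641927633]`, optimal, Manin constant 1; the cyclic level `129371761 = 7253·17837 ∈ 𝒩₂`:
`7253 ≡ 17837 ≡ 1 (mod 49)`, `#Ẽ(𝔽₇₂₅₃) = 7154 = 2·7²·73`, `#Ẽ(𝔽₁₇₈₃₇) = 18032 = 2⁴·7²·23`, cyclicity ladders `1022 • (0, 6839) ≠ O` /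
`2576 • (0, 10235) ≠ O` — all the record's KERNEL lemmas reused by name), through `X6RankZero.missingLowerBoundAt_of_kimLowerLT_of_ainvs`
(p556626). BINDERS — `hKim` (twin, UNFLAGGED), `hGZK`, `hmod`, `r_an = 0`, `2 ≤ ord₇ ∏c + 1` (Cremona), `D` with `7 ∤ c_D`, the period
transfer, a surjective `ψ`, and `hδ` = `δ̃⁽²⁾` at `129371761` non-zero mod `49` (valued `14 (mod 49)`; TWO EXACT engines: engine Q kit
j241847 and PARI `msfromell` kit j241528, as displayed by the road of record / x10b X6-KURIHARA §28). Per pair; class X6 unchanged;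
nothing booked. [cite: Kim2022StructureSelmer, Thm. 1.9 (6) (PDF p. 8) and §1.5.3 (PDF p. 8)] [cite: SilvermanAEC2009, III.2.3 and VII.5 Prop. 5.1]
[cite: Kraus1989, Prop. 1 and Prop. 2] [cite: Cremona2006, Table 1 (Cremona label 130798a1)] -/
theorem X6RankZero.missingLowerBoundAt_cell_130798a1_at7_LT [Fact (Nat.Prime 7)]
    (hKim : Kim2026.rankZero_le_padicValNat_sha_of_kuriharaNumber_ne_zero_of_localTorsionTrivial)
    (hGZK : rank_eq_analyticRank_of_analyticRank_le_one) (hmod : hasEntireLFunction_rat)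
    {W : WeierstrassCurve ℚ} [W.IsElliptic] [W.IsGloballyMinimal]
    (hW : W = ⟨1, 1, 1, -1514781218, -22692641927633⟩) (hr0 : W.analyticRank = 0)
    (hkt : 2 ≤ padicValNat 7 W.tamagawaProduct + 1)
    {N : ℕ} [NeZero N] (D : ModularParametrizationData W N) (hc : ¬ (7 : ℤ) ∣ D.maninConstant)
    (hper : ∃ u : ℚ, ‖(u : ℚ_[7])‖ = 1 ∧ W.realPeriodRat = u * plusPeriod D.f)
    (ψ : (ℓ : ℕ) → (ZMod ℓ)ˣ →* Multiplicative (ZMod (7 ^ 2)))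
    (hψ₁ : Function.Surjective (ψ 7253)) (hψ₂ : Function.Surjective (ψ 17837))
    (hδ : kuriharaNumber D.f (7 ^ 2) (7253 * 17837) ψ ≠ 0) : MissingLowerBoundAt W 7 := by
  subst hW
  haveI : Fact (Nat.Prime 7253) := ⟨by norm_num⟩
  haveI : Fact (Nat.Prime 17837) := ⟨by norm_num⟩
  exact X6RankZero.missingLowerBoundAt_of_kimLowerLT_of_ainvs hKim hGZK hmod 1 1 1 (-1514781218) (-22692641927633)
    isGloballyMinimal_c130798a1
    7 (by norm_num) (by decide) (np := 8) (countPoints_eq_of_fast (by decide +kernel)) (by decide) (by decide +kernel)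
    2 (by norm_num) 7253 17837 (by norm_num) (by norm_num) (by norm_num) (by norm_num) (by norm_num) (by decide) (by decide)
    (by decide) (by decide) (n₁ := 7154) (n₂ := 18032) countPoints_c130798a1_7253 countPoints_c130798a1_17837 (by decide) (by decide)
    card_torsion_le_c130798a1_7253_7 card_torsion_le_c130798a1_17837_7
    hr0 hkt D hc hper ψ hψ₁ hψ₂ hδ

/-- **The erratum sub-leaf's conclusion (= E₅'s conclusion) AT THE CELL `(130798a1, 7)`, flag-free on the lower half** — for every rational
`q` with `#Ш(E)_an = q` (and `ord₇ q ≠ 0`, unused): `ord₇ q ≤ ord₇ #Ш(E/ℚ)`, from `X6RankZero.missingLowerBoundAt_cell_130798a1_at7_LT` and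
`padicValRat_le_of_missingLowerBoundAt`. Binders as there (Kim twin, GZK, modularity; the displayed data of the road of record). Per pair;
NOT a class theorem; no pack `PublishedAcInputsX6Err` consumed; nothing booked. [cite: Kim2022StructureSelmer, Thm. 1.9 (6) (PDF p. 8)]
[cite: Miller2011LMS, Def. 1.1] [cite: Cremona2006, Table 1 (Cremona label 130798a1)] -/
theorem X6RankZero.eisensteinHalfFiveLe_cell_130798a1_at7_LT [Fact (Nat.Prime 7)]
    (hKim : Kim2026.rankZero_le_padicValNat_sha_of_kuriharaNumber_ne_zero_of_localTorsionTrivial)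
    (hGZK : rank_eq_analyticRank_of_analyticRank_le_one) (hmod : hasEntireLFunction_rat)
    {W : WeierstrassCurve ℚ} [W.IsElliptic] [W.IsGloballyMinimal]
    (hW : W = ⟨1, 1, 1, -1514781218, -22692641927633⟩) (hr0 : W.analyticRank = 0)
    (hkt : 2 ≤ padicValNat 7 W.tamagawaProduct + 1)
    {N : ℕ} [NeZero N] (D : ModularParametrizationData W N) (hc : ¬ (7 : ℤ) ∣ D.maninConstant)
    (hper : ∃ u : ℚ, ‖(u : ℚ_[7])‖ = 1 ∧ W.realPeriodRat = u * plusPeriod D.f)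
    (ψ : (ℓ : ℕ) → (ZMod ℓ)ˣ →* Multiplicative (ZMod (7 ^ 2)))
    (hψ₁ : Function.Surjective (ψ 7253)) (hψ₂ : Function.Surjective (ψ 17837))
    (hδ : kuriharaNumber D.f (7 ^ 2) (7253 * 17837) ψ ≠ 0) :
    ∀ q : ℚ, shaAn W = (q : ℂ) → padicValRat 7 q ≠ 0 → padicValRat 7 q ≤ (padicValNat 7 W.shaOrder : ℤ) := by
  intro q hq _
  exact padicValRat_le_of_missingLowerBoundAt W 7
    (X6RankZero.missingLowerBoundAt_cell_130798a1_at7_LT hKim hGZK hmod hW hr0 hkt D hc hper ψ hψ₁ hψ₂ hδ) q hq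

end Summit.BirchSwinnertonDyer.Rank1Residual.Supersingular

end
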